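import Literature.NumberTheory.EllipticCurves.RootNumberTwistProofs
import Literature.NumberTheory.EllipticCurves.RootNumberLocalSmulProofs
import Literature.NumberTheory.QuadraticForms.PadicHilbertSymbol
import HarnessLib

/-!
# Quadratic twists by a `p`-adic square: the base changes to `ℚ_p` are isomorphic — proofs

A `…Proofs` file (theorems only). If an integer `d ≠ 0` is a square in `ℚ_p`, `d = θ²`, then
`E^{(d)} ⊗ ℚ_p = (E ⊗ ℚ_p)^{(θ²)} ≅ E ⊗ ℚ_p` (Silverman, *AEC* X.5 Cor. 5.4 (iii); the tree's
`map_quadraticTwist`, `exists_variableChange_smul_eq_quadraticTwist_sq`), so `E^{(d)}` and `E` have the same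
local root number `W_p` (Rohrlich 1994, §19: `W(E/ℚ_p)` is an invariant of `E ⊗ ℚ_p`;
`localRootNumber_smul_holds`) and the same reduction type at `p` (AEC VII.5 Prop. 5.1). The square is
supplied by `(d/p) = 1` for odd `p` and by `d ≡ 1 (mod 8)` for `p = 2` (Serre, *Cours d'arithmétique*
II.3.3; the tree's `padic_isSquare_intCast_of_isSquare_zmod`, `padic_isSquare_intCast_of_mod_eight`).
Used by `RootNumberQuadraticTwistSharedPrimeProofs` (the root number of a twist ramified at a multiplicative
prime). No definitions, no named facts.

## References

* [SilvermanAEC2009] J. H. Silverman, *The Arithmetic of Elliptic Curves*, 2nd ed., VII.5 Prop. 5.1, X.5 Cor. 5.4.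
* [Rohrlich1994CRM] D. Rohrlich, *Elliptic curves and the Weil–Deligne group*, CRM Proc. 4 (1994), §19.
* [Serre1973] J.-P. Serre, *A course in arithmetic*, Ch. II §3.3.
-/

noncomputable section

open scoped Classical

open Literature.NumberTheory.EllipticCurves.ModularForms IsDedekindDomain
  IsDedekindDomain.HeightOneSpectrum NumberField Rat.HeightOneSpectrum

namespace WeierstrassCurve

variable (W : WeierstrassCurve ℚ)

/-! ### §1 Twisting by a `p`-adic square: the base changes to `ℚ_p` are isomorphic -/

section LocalSquare

variable {p : ℕ} [Fact p.Prime]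

/-- **Twisting by a `p`-adic square is a `ℚ_p`-isomorphism.** If the integer `d ≠ 0` is a square in
`ℚ_p`, `d = θ²`, then `E^{(d)} ⊗ ℚ_p = (E ⊗ ℚ_p)^{(θ²)} = C • (E ⊗ ℚ_p)` for a change of variables `C`
over `ℚ_p` (`map_quadraticTwist`, `exists_variableChange_smul_eq_quadraticTwist_sq`; Silverman,
*AEC* X.5 Cor. 5.4 (iii)). [cite: SilvermanAEC2009, X.5 Cor. 5.4] -/
theorem exists_variableChange_baseChange_quadraticTwist_of_isSquare {d : ℤ} (hd : d ≠ 0)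
    (hsq : IsSquare ((d : ℤ) : ℚ_[p])) :
    ∃ C : VariableChange ℚ_[p],
      (W.quadraticTwist (d : ℚ)).baseChange ℚ_[p] = C • W.baseChange ℚ_[p] := by
  obtain ⟨θ, hθ⟩ := hsq
  have hθ0 : θ ≠ 0 := by
    rintro rfl
    exact (show ((d : ℤ) : ℚ_[p]) ≠ 0 by exact_mod_cast hd) (by rw [hθ, mul_zero])
  obtain ⟨C, hC⟩ := (W.baseChange ℚ_[p]).exists_variableChange_smul_eq_quadraticTwist_sq hθ0
  refine ⟨C, ?_⟩
  have htw : (W.quadraticTwist (d : ℚ)).baseChange ℚ_[p] =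
      (W.baseChange ℚ_[p]).quadraticTwist ((d : ℤ) : ℚ_[p]) := by
    rw [baseChange, map_quadraticTwist, map_intCast]; rfl
  rw [htw, hC, hθ, sq]

/-- The local root number over `ℤ_p` of a twist by a `p`-adic square is that of the curve
(`W(E/ℚ_p)` is an invariant of `E ⊗ ℚ_p`, `localRootNumber_smul_holds`; Rohrlich 1994, §19).
[cite: Rohrlich1994CRM, §19] -/
theorem localRootNumber_padic_quadraticTwist_of_isSquare [W.IsElliptic] {d : ℤ} (hd : d ≠ 0)
    (hsq : IsSquare ((d : ℤ) : ℚ_[p])) :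
    ((W.quadraticTwist (d : ℚ)).baseChange ℚ_[p]).localRootNumber ℤ_[p] =
      (W.baseChange ℚ_[p]).localRootNumber ℤ_[p] := by
  haveI : (W.baseChange ℚ_[p]).IsElliptic := by change (W.map _).IsElliptic; infer_instance
  obtain ⟨C, hC⟩ := W.exists_variableChange_baseChange_quadraticTwist_of_isSquare hd hsq
  rw [hC]
  exact (W.baseChange ℚ_[p]).localRootNumber_smul_holds ℤ_[p] C

/-- Additive reduction over `ℤ_p` of a twist by a `p`-adic square iff of the curve (the minimal models
of `ℚ_p`-isomorphic curves differ by an integral change of variables; Silverman, *AEC* VII.1 Prop. 1.3 (b),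
VII.5 Prop. 5.1 (c)). [cite: SilvermanAEC2009, VII.5 Prop. 5.1] -/
theorem hasAdditiveReduction_padic_quadraticTwist_iff_of_isSquare [W.IsElliptic] {d : ℤ} (hd : d ≠ 0)
    (hsq : IsSquare ((d : ℤ) : ℚ_[p])) :
    (((W.quadraticTwist (d : ℚ)).baseChange ℚ_[p]).minimal ℤ_[p]).HasAdditiveReduction ℤ_[p] ↔
      ((W.baseChange ℚ_[p]).minimal ℤ_[p]).HasAdditiveReduction ℤ_[p] := by
  haveI : (W.baseChange ℚ_[p]).IsElliptic := by change (W.map _).IsElliptic; infer_instance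
  haveI : ((W.baseChange ℚ_[p]).minimal ℤ_[p]).IsElliptic := by unfold minimal; infer_instance
  obtain ⟨C, hC⟩ := W.exists_variableChange_baseChange_quadraticTwist_of_isSquare hd hsq
  obtain ⟨D, hD⟩ : ∃ D : VariableChange ℚ_[p],
      (W.baseChange ℚ_[p]).minimal ℤ_[p] = D • W.baseChange ℚ_[p] := ⟨_, rfl⟩
  obtain ⟨D', hD'⟩ : ∃ D' : VariableChange ℚ_[p],
      ((W.quadraticTwist (d : ℚ)).baseChange ℚ_[p]).minimal ℤ_[p] =
        D' • (W.quadraticTwist (d : ℚ)).baseChange ℚ_[p] := ⟨_, rfl⟩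
  have hrel : ((W.quadraticTwist (d : ℚ)).baseChange ℚ_[p]).minimal ℤ_[p] =
      (D' * C * D⁻¹) • (W.baseChange ℚ_[p]).minimal ℤ_[p] := by
    rw [hD', hC, mul_smul, mul_smul, hD, inv_smul_smul]
  exact hasAdditiveReduction_iff_of_isMinimal_of_eq_smul ℤ_[p] hrel
    ((W.baseChange ℚ_[p]).minimal ℤ_[p]).isUnit_Δ.ne_zero

/-- Place-indexed form: at the place of `ℤ` under `p`, `W_p(E^{(d)}) = W_p(E)` for `d` a `p`-adic square.
[cite: Rohrlich1994CRM, §19] -/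
theorem localRootNumberAt_quadraticTwist_of_isSquare [W.IsElliptic] (p : Nat.Primes) {d : ℤ} (hd : d ≠ 0)
    (hsq : haveI := Fact.mk p.2; IsSquare ((d : ℤ) : ℚ_[p])) :
    (W.quadraticTwist (d : ℚ)).localRootNumberAt ((primesEquiv (R := ℤ)).symm p) =
      W.localRootNumberAt ((primesEquiv (R := ℤ)).symm p) := by
  haveI := Fact.mk p.2
  haveI := W.isElliptic_quadraticTwist (show (d : ℚ) ≠ 0 by exact_mod_cast hd)
  rw [localRootNumberAt_primesEquiv_symm_eq, localRootNumberAt_primesEquiv_symm_eq]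
  exact W.localRootNumber_padic_quadraticTwist_of_isSquare hd hsq

/-- Place-indexed form: at the place of `ℤ` under `p`, `E^{(d)}` is additive iff `E` is, for `d` a
`p`-adic square. [cite: SilvermanAEC2009, VII.5 Prop. 5.1] -/
theorem hasAdditiveReductionAt_quadraticTwist_iff_of_isSquare [W.IsElliptic] (p : Nat.Primes) {d : ℤ}
    (hd : d ≠ 0) (hsq : haveI := Fact.mk p.2; IsSquare ((d : ℤ) : ℚ_[p])) :
    (W.quadraticTwist (d : ℚ)).HasAdditiveReductionAt ((primesEquiv (R := ℤ)).symm p) ↔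
      W.HasAdditiveReductionAt ((primesEquiv (R := ℤ)).symm p) := by
  haveI := Fact.mk p.2
  haveI := W.isElliptic_quadraticTwist (show (d : ℚ) ≠ 0 by exact_mod_cast hd)
  rw [← W.hasAdditiveReduction_padic_iff_hasAdditiveReductionAt_int p,
    ← (W.quadraticTwist (d : ℚ)).hasAdditiveReduction_padic_iff_hasAdditiveReductionAt_int p]
  exact W.hasAdditiveReduction_padic_quadraticTwist_iff_of_isSquare hd hsq

/-- **Odd `p`: `(d/p) = 1` makes `d` a square in `ℚ_p`** (Euler's criterion and Hensel's lemma;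
Serre, *Cours d'arithmétique* II.3.3 Thm. 3). [cite: Serre1973, Ch. II §3.3 Thm 3] -/
theorem isSquare_padic_of_jacobiSym_eq_one (hp2 : p ≠ 2) {d : ℤ} (hj : jacobiSym d p = 1) :
    IsSquare ((d : ℤ) : ℚ_[p]) := by
  rw [← jacobiSym.legendreSym.to_jacobiSym] at hj
  have h0 : (d : ZMod p) ≠ 0 := fun h ↦ by
    rw [(legendreSym.eq_zero_iff p d).mpr h] at hj; exact zero_ne_one hj
  have hsq : IsSquare (d : ZMod p) := (legendreSym.eq_one_iff p h0).mp hj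
  have hnd : ¬ (p : ℤ) ∣ d := fun h ↦ h0 ((ZMod.intCast_zmod_eq_zero_iff_dvd d p).mpr h)
  exact Literature.NumberTheory.QuadraticForms.padic_isSquare_intCast_of_isSquare_zmod hp2 hnd hsq

/-- **`p = 2`: `d ≡ 1 (mod 8)` makes `d` a square in `ℚ_2`** (Serre II.3.3 Thm. 4).
[cite: Serre1973, Ch. II §3.3 Thm 4] -/
theorem isSquare_padic_of_emod_eight_eq_one (hp2 : p = 2) {d : ℤ} (hd : d % 8 = 1) :
    IsSquare ((d : ℤ) : ℚ_[p]) :=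
  Literature.NumberTheory.QuadraticForms.padic_isSquare_intCast_of_mod_eight hp2 hd

end LocalSquare


end WeierstrassCurve

end
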